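/-
Origin: expansion seat `prover-pub-hodgecm-mc-sinst-1-g10-0`, handover #1252 2026-08-20T23:19Z md5 661a96c277e5 (89 l.; NEW additive DROP-ALONE leaf, ns HodgeCM.Model.SupplyResidual.WeilPairData, generic over ANY WeilPairData P: thetaLift_act_torus (Θ_{ω(1,t)Φ}(charInv χ) = χ(t)⁻¹ · Θ_Φ(charInv χ), any t ∈ ker N(𝔸)), thetaLift_charInv_eq_zero_of_weight_ne / thetaLiftFun_charInv_eq_zero_of_weight_ne (TORUS-WEIGHT ORTHOGONALITY: ω(1,t)Φ = c • Φ with c ≠ χ(t)⁻¹ ⇒ Θ_Φ(charInv χ) = 0) — the PROVE half of the (J4-mult1) residual of row 9; imports #1246 only (RUN 65, installed); cert 2026-08-20T23:16:58Z rc=0 wall=7s 0/0/0, axioms 3/3 trio; NAMES for audit: HodgeCM.Model.SupplyResidual.WeilPairData.thetaLift_act_torus · HodgeCM.Model.SupplyResidual.WeilPairData.thetaLift_charInv_eq_zero_of_weight_ne · HodgeCM.Model.SupplyResidual.WeilPairData.thetaLiftFun_charInv_eq_zero_of_weight_ne) (`HOME/mc/pub-hodgecm-mc-sinst-1-g10/stage66/HodgeCM/Model/AdelicThetaDistributionTorus.lean`,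 md5 661a96c277e5, 89 lines);
landed by the second packager p2 gen 15 (p2-g15) in gate run 66 as `HodgeCM/Model/AdelicThetaDistributionTorus.lean` (verbatim).
-/
/-
Copyright (c) 2026 the pub-hodgecm formalisation cell (harness21).  New file, not vendored.
Origin: session prover-pub-hodgecm-mc-sinst-1-g10-0 (unit pub-hodgecm-mc-sinst-1-g10, S-INSTANCE CONSTRUCTOR gen 10; TORUS-WEIGHT ORTHOGONALITY for the
theta lifts of a pair datum against `charInv χ` — the PROVE half of the (J4-hol)/(J4-mult1) residual of row 9), 2026-08-20.
Intended final place: `HodgeCM/Model/AdelicThetaDistributionTorus.lean` (NEW additive model-layer leaf; imports sinst-1's `Model/AdelicThetaDistribution`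
(#1246) only; nothing imports it; drop alone).
-/
import Summits.HodgeConjecture.HodgeCM.Model.AdelicThetaDistribution

set_option autoImplicit false

/-!
# Torus-weight orthogonality of the theta lift against `charInv χ`

For ANY pair datum `P : WeilPairData K L J GU` (tree `ThetaKernelDatum` of the pair), any test vector `Φ`, any torus element
`t ∈ ker N_{L/K}(𝔸)` and any character `χ` of `[U(W)] = ker N(𝔸)/ker N(K)`:
* `thetaLift_act_torus` — `Θ_{ω(1,t)Φ}(charInv χ) = χ(t)⁻¹ · Θ_Φ(charInv χ)` (translation invariance of the Haar measure of `[U(W)]`, #1246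
  `charInv_eq_smul_translate` + tree `thetaLift_act_right`; the finite-torus case is #1246 `thetaLift_fam_ωf_W`);
* **`thetaLift_charInv_eq_zero_of_weight_ne`** — if `Φ` is a WEIGHT VECTOR of the torus element `t`, `ω(1,t) Φ = c • Φ`, with `c ≠ χ(t)⁻¹`,
  then `Θ_Φ(charInv χ) = 0`: the theta lift against `charInv χ` only sees the `χ⁻¹`-weight component of the test vector under `U(W)(𝔸)` — in
  particular under the ARCHIMEDEAN torus `U(W)(L⁺ ⊗ ℝ)` (carch #CA60 `lineRepOf_k_one_inf_eq_adelicTensorEnd` gives its action on pure tensors).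
This is the kernel ("finite-dimensional character theory on `U(1)`") half of the reduction of an arbitrary archimedean test vector of a strict situation
to the standard harmonic family; the other half is the archimedean multiplicity-one statement (J4-mult1) ([Howe 1989, (3.13)], a CITE).
KERNEL only: 0 records, 0 `def … : Prop`, nothing cited as a sentence.
-/

noncomputable section

open MeasureTheory IsDedekindDomain NumberField.mixedEmbedding
open NumberField hiding relNormOneIdeles relNormOneRat probHaarRelNormOneQuot
open Literature.NumberTheory.Automorphic Literature.NumberTheory.Weil1964
open HodgeCM.Model.SupplyResidual
open scoped Classical

namespace HodgeCM
namespace Model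
namespace SupplyResidual.WeilPairData

variable {K L : Type} [Field K] [NumberField K] [Field L] [NumberField L] [Algebra K L] [FiniteDimensional K L]
variable {J : Type} [Fintype J] {GU : Type} [Group GU] [TopologicalSpace GU] [IsTopologicalGroup GU] [LocallyCompactSpace GU]
variable (P : WeilPairData K L J GU) [CompactSpace (GU ⧸ P.ΓU)]

/-- **Torus translation of the test vector multiplies the `charInv χ`-lift by `χ(t)⁻¹`.** -/
theorem thetaLift_act_torus (Φ : P.weilDatum.ThetaTop) (t : ↥(relNormOneIdeles K L))
    (χ : PontryaginDual (↥(relNormOneIdeles K L) ⧸ relNormOneRat K L)) (ξ : GU ⧸ P.ΓU) :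
    P.kernelDatum.thetaLift (probHaarRelNormOneQuot K L) (P.kernelDatum.W.act (P.kernelDatum.s (1, t)) Φ) (charInv χ) ξ =
      (((χ (QuotientGroup.mk t))⁻¹ : Circle) : ℂ) * P.kernelDatum.thetaLift (probHaarRelNormOneQuot K L) Φ (charInv χ) ξ := by
  rw [P.kernelDatum.thetaLift_act_right (probHaarRelNormOneQuot K L) Φ t (fun q => charInv_eq_smul_translate' χ t q),
    ThetaKernelDatum.thetaLift_smul, ContinuousMap.smul_apply, smul_eq_mul]
where
  /-- `charInv χ (q) = χ(t)⁻¹ · charInv χ (t⁻¹ • q)` (the #1246 identity, any fields). -/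
  charInv_eq_smul_translate' (χ : PontryaginDual (↥(relNormOneIdeles K L) ⧸ relNormOneRat K L)) (t : ↥(relNormOneIdeles K L))
      (q : ↥(relNormOneIdeles K L) ⧸ relNormOneRat K L) :
      charInv χ q = ((((χ (QuotientGroup.mk t))⁻¹ : Circle) : ℂ) • charInv χ) (t⁻¹ • q) := by
    induction q using QuotientGroup.induction_on with
    | H y =>
      have harg : ((QuotientGroup.mk y : ↥(relNormOneIdeles K L) ⧸ relNormOneRat K L))⁻¹ =
          (QuotientGroup.mk t : _ ⧸ relNormOneRat K L)⁻¹ * (QuotientGroup.mk (t⁻¹ * y) : _ ⧸ relNormOneRat K L)⁻¹ := by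
        rw [← QuotientGroup.mk_inv, ← QuotientGroup.mk_inv, ← QuotientGroup.mk_inv, ← QuotientGroup.mk_mul, mul_inv_rev, inv_inv, ← mul_assoc,
          inv_mul_cancel_comm]
      rw [MulAction.Quotient.smul_mk, smul_eq_mul, ContinuousMap.smul_apply, smul_eq_mul, WeilPairData.charInv_apply, WeilPairData.charInv_apply,
        ← Circle.coe_mul, ← map_inv, ← map_mul, ← harg]

/-- **TORUS-WEIGHT ORTHOGONALITY**: a weight vector `Φ` of the torus element `t` (`ω(1,t) Φ = c • Φ`) with `c ≠ χ(t)⁻¹` has vanishing theta lift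
against `charInv χ`. -/
theorem thetaLift_charInv_eq_zero_of_weight_ne (Φ : P.weilDatum.ThetaTop) (t : ↥(relNormOneIdeles K L)) {c : ℂ}
    (hΦ : P.kernelDatum.W.act (P.kernelDatum.s (1, t)) Φ = c • Φ) (χ : PontryaginDual (↥(relNormOneIdeles K L) ⧸ relNormOneRat K L))
    (hc : c ≠ (((χ (QuotientGroup.mk t))⁻¹ : Circle) : ℂ)) (ξ : GU ⧸ P.ΓU) :
    P.kernelDatum.thetaLift (probHaarRelNormOneQuot K L) Φ (charInv χ) ξ = 0 := by
  have h := P.thetaLift_act_torus Φ t χ ξ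
  rw [hΦ, (P.kernelDatum.thetaLift_smul_left (probHaarRelNormOneQuot K L) P.kernelDatum_thetaLinear c Φ (charInv χ)),
    ContinuousMap.smul_apply, smul_eq_mul] at h
  have h' : (c - (((χ (QuotientGroup.mk t))⁻¹ : Circle) : ℂ)) * P.kernelDatum.thetaLift (probHaarRelNormOneQuot K L) Φ (charInv χ) ξ = 0 := by
    rw [sub_mul, h, sub_self]
  exact (mul_eq_zero.mp h').resolve_left (sub_ne_zero.mpr hc)

/-- The same on the group: `Θ̃_Φ(charInv χ) ≡ 0` for a torus weight vector of the wrong weight. -/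
theorem thetaLiftFun_charInv_eq_zero_of_weight_ne (Φ : P.weilDatum.ThetaTop) (t : ↥(relNormOneIdeles K L)) {c : ℂ}
    (hΦ : P.kernelDatum.W.act (P.kernelDatum.s (1, t)) Φ = c • Φ) (χ : PontryaginDual (↥(relNormOneIdeles K L) ⧸ relNormOneRat K L))
    (hc : c ≠ (((χ (QuotientGroup.mk t))⁻¹ : Circle) : ℂ)) (g : GU) :
    P.kernelDatum.thetaLiftFun (probHaarRelNormOneQuot K L) Φ (charInv χ) g = 0 := by
  rw [ThetaKernelDatum.thetaLiftFun_apply]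
  exact P.thetaLift_charInv_eq_zero_of_weight_ne Φ t hΦ χ hc _

end SupplyResidual.WeilPairData
end Model
end HodgeCM

end
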